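import Summits.QuantumFields.YangMills.Theorems.FemtoTransferGapAxisPermutation
import HarnessLib

/-!
# Elementary helpers for the Cauchy–Schwarz door of `SwapTwistDeficit`: swap-odd integrals vanish, series Cauchy–Schwarz, double sums

Support module (route-independent imports) for `Theorems/SwapTwistDeficitCauchySchwarzDoor.lean` (item stmt-QuantumFields-23319, aside of
route `SwapTwistDeficit`, D-0145 LINE g10-B of seat ym-idea-4):

* `integral_eq_zero_of_swap_odd` — the integral of a function odd under the spatial axis swap `(0 1)` vanishes (the swap preserves the a-priori
  product Haar measure `configMeasure`);
* `tsum_mul_sq_le` — Cauchy–Schwarz for non-negative series in discriminant form, `(Σ u v)² ≤ (Σ u²)(Σ v²)`;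
* `summable_prod_of_rows` ∕ `summable_prod_of_cols` ∕ `summable_weighted_cols` — summation of non-negative double families on `ℕ × ℕ` by rows,
  by columns, and with a bounded weight against row-bounded families.

HONEST FRAMING: bookkeeping only; nothing here bears on infinite volume, the continuum limit, a mass gap or Clay.
References: [folklore].
-/

set_option autoImplicit false

noncomputable section

open MeasureTheory Filter Topology Function
open Literature.MathematicalPhysics.QuantumFieldTheory
open Literature.MathematicalPhysics.QuantumLattice
open Literature.Analysis.OperatorTheory.YMMatrixModel
open scoped BigOperators

namespace Summit.QuantumFields.YangMills.Theorems.SwapTwistDeficit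

open Summit.QuantumFields.YangMills.Theorems.FemtoTransferGap

/-- The integral of a swap-odd function vanishes (the axis swap preserves the a-priori measure). [folklore] -/
theorem integral_eq_zero_of_swap_odd {L : ℕ} [NeZero L] (u : GaugeConfig 3 L FemtoTransferGap.SU2 → ℝ)
    (hu : ∀ U, u (configPerm (Equiv.swap 0 1) U) = -u U) :
    ∫ U, u U ∂configMeasure FemtoTransferGap.SU2 L = 0 := by
  have h : ∫ U, u U ∂configMeasure FemtoTransferGap.SU2 L = -∫ U, u U ∂configMeasure FemtoTransferGap.SU2 L := by
    conv_lhs => rw [← (measurePreserving_configPerm' (L := L) (Equiv.swap 0 1)).integral_comp' (f := configPerm (Equiv.swap 0 1)) u]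
    rw [← integral_neg]
    exact integral_congr_ae (ae_of_all _ fun U => hu U)
  linarith

/-- **Cauchy–Schwarz for series** (discriminant form): for `u, v ≥ 0` with `Σ u² = A`, `Σ v² = B`, the series `Σ u v` converges and
`(Σ u v)² ≤ A · B`. [folklore] -/
theorem tsum_mul_sq_le {γ : Type*} {u v : γ → ℝ} (hu0 : ∀ p, 0 ≤ u p) (hv0 : ∀ p, 0 ≤ v p) {A B : ℝ}
    (hA : HasSum (fun p => u p ^ 2) A) (hB : HasSum (fun p => v p ^ 2) B) :
    Summable (fun p => u p * v p) ∧ (∑' p, u p * v p) ^ 2 ≤ A * B := by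
  have hs : Summable (fun p => u p * v p) := by
    refine Summable.of_nonneg_of_le (fun p => mul_nonneg (hu0 p) (hv0 p)) (fun p => ?_) ((hA.summable.add hB.summable).div_const 2)
    nlinarith [sq_nonneg (u p - v p)]
  refine ⟨hs, ?_⟩
  have hquad : ∀ t : ℝ, 0 ≤ A * (t * t) + (-2 * ∑' p, u p * v p) * t + B := fun t => by
    have h1 : HasSum (fun p => (t * u p - v p) ^ 2) (t * t * A - 2 * t * (∑' p, u p * v p) + B) := by
      have h := ((hA.mul_left (t * t)).sub ((hs.hasSum).mul_left (2 * t))).add hB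
      exact h.congr_fun fun p => by ring
    have h2 := h1.nonneg fun p => sq_nonneg _
    linarith
  have hd := discrim_le_zero hquad
  rw [discrim] at hd
  nlinarith [hd]

/-- Row-wise summation of a non-negative double family. [folklore] -/
theorem summable_prod_of_rows {F : ℕ × ℕ → ℝ} (h0 : ∀ p, 0 ≤ F p) {g : ℕ → ℝ} (hrow : ∀ k, HasSum (fun l => F (k, l)) (g k))
    (hg : Summable g) : Summable F ∧ HasSum F (∑' k, g k) := by
  have hF : Summable F := by
    refine (summable_prod_of_nonneg h0).mpr ⟨fun k => (hrow k).summable, ?_⟩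
    exact hg.congr fun k => ((hrow k).tsum_eq).symm
  exact ⟨hF, (hF.hasSum.prod_fiberwise hrow).tsum_eq ▸ hF.hasSum⟩

/-- Column-wise summation of a non-negative double family. [folklore] -/
theorem summable_prod_of_cols {F : ℕ × ℕ → ℝ} (h0 : ∀ p, 0 ≤ F p) {g : ℕ → ℝ} (hcol : ∀ l, HasSum (fun k => F (k, l)) (g l))
    (hg : Summable g) : Summable F ∧ HasSum F (∑' l, g l) := by
  obtain ⟨h1, h2⟩ := summable_prod_of_rows (F := fun p : ℕ × ℕ => F (p.2, p.1)) (fun p => h0 _) hcol hg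
  have e : (fun p : ℕ × ℕ => F (p.2, p.1)) = F ∘ (Equiv.prodComm ℕ ℕ) := by
    funext p; rfl
  rw [e] at h1 h2
  exact ⟨(Equiv.prodComm ℕ ℕ).summable_iff.mp h1, (Equiv.prodComm ℕ ℕ).hasSum_iff.mp h2⟩

/-- A weighted row-bounded family: if `0 ≤ w_k ≤ W`, `Σ_k r_{lk}` converges with sum `≤ R_l`, `R_l, r ≥ 0` and `Σ_l c_l R_l` converges (`c ≥ 0`),
then `(k,l) ↦ c_l w_k r_{lk}` is summable. [folklore] -/
theorem summable_weighted_cols {w c R : ℕ → ℝ} {r : ℕ → ℕ → ℝ} {W : ℝ} (hw0 : ∀ k, 0 ≤ w k) (hwW : ∀ k, w k ≤ W) (hc0 : ∀ l, 0 ≤ c l)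
    (hr0 : ∀ l k, 0 ≤ r l k) (hr : ∀ l, Summable (r l) ∧ ∑' k, r l k ≤ R l) (hR : Summable fun l => c l * R l) :
    Summable fun p : ℕ × ℕ => c p.2 * w p.1 * r p.2 p.1 := by
  have hW : 0 ≤ W := (hw0 0).trans (hwW 0)
  have hs : ∀ l, Summable fun k => w k * r l k := fun l =>
    Summable.of_nonneg_of_le (fun k => mul_nonneg (hw0 k) (hr0 l k)) (fun k => mul_le_mul_of_nonneg_right (hwW k) (hr0 l k))
      ((hr l).1.mul_left W)
  have hcol : ∀ l, HasSum (fun k => c l * w k * r l k) (c l * ∑' k, w k * r l k) := fun l => by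
    refine ((hs l).hasSum.mul_left (c l)).congr_fun fun k => ?_
    ring
  have hle : ∀ l, ∑' k, w k * r l k ≤ W * R l := fun l =>
    calc ∑' k, w k * r l k ≤ ∑' k, W * r l k :=
          (hs l).tsum_le_tsum (fun k => mul_le_mul_of_nonneg_right (hwW k) (hr0 l k)) ((hr l).1.mul_left W)
      _ = W * ∑' k, r l k := tsum_mul_left
      _ ≤ W * R l := mul_le_mul_of_nonneg_left (hr l).2 hW
  have hg : Summable fun l => c l * ∑' k, w k * r l k := by
    refine Summable.of_nonneg_of_le (fun l => mul_nonneg (hc0 l) (tsum_nonneg fun k => mul_nonneg (hw0 k) (hr0 l k)))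
      (fun l => ?_) (hR.mul_left W)
    calc c l * ∑' k, w k * r l k ≤ c l * (W * R l) := mul_le_mul_of_nonneg_left (hle l) (hc0 l)
      _ = W * (c l * R l) := by ring
  exact (summable_prod_of_cols (F := fun p : ℕ × ℕ => c p.2 * w p.1 * r p.2 p.1)
    (fun p => mul_nonneg (mul_nonneg (hc0 _) (hw0 _)) (hr0 _ _)) hcol hg).1

end Summit.QuantumFields.YangMills.Theorems.SwapTwistDeficit

end
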